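import Summits.CriticalPhenomena.PercolationContinuityZ3.Theorems.SahiCISCoupling
import Summits.CriticalPhenomena.PercolationContinuityZ3.Theorems.SahiCISMonotoneVersion
import Summits.CriticalPhenomena.PercolationContinuityZ3.Theorems.SahiBoxTP2PositiveAssociation
import Summits.CriticalPhenomena.PercolationContinuityZ3.Theorems.PercNearOneGluingNoHeavyLowerTailSahiGridPatternKernel

/-!
# CIS laws (a.e.-kernel sense) are monotone images of Lebesgue measure: positive association and Sahi
# positivity of every order given `L(d,n)`, unconditional for `d ≤ 2`, `n ≤ 2` and `(d,n) = (3,3)`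

Cell `prim-sahi`, typer (generation 17); `--supports stmt-CriticalPhenomena-4575`.  Theorems only (no definitions,
no named facts, no sorries).

Assembly of `SahiCISCoupling.lean` (standard construction, monotone on almost every pair) and
`SahiCISMonotoneVersion.lean` (monotone Borel versions on the cube):

* **`IsCISae.exists_monotone_coupling`** — every probability law `μ` on `Q_d = [0,1]^d` that is conditionally
  increasing in sequence in the a.e.-kernel sense (`IsCISae d μ`) is `G_* λ_d` for a Borel map `G : Q_d → Q_d`
  that is MONOTONE EVERYWHERE.  (Müller–Stoyan Lemma 3.10.10 "X is CIS iff Ψ*_F is increasing", here for ARBITRARY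
  laws — singular, atomic — with the kernel hypothesis read almost everywhere in pairs, which is all that a
  disintegration can be asked to satisfy.)
* Consequences, each by pulling back along `G`: **`IsCISae.isPositivelyAssociated`** (FKG inequality for all
  measurable increasing events, the tree's `IsPositivelyAssociated`; Müller–Stoyan Thm. 3.10.11 "CIS ⇒ associated"
  without densities), `IsCISae.integral_mul_integral_le`; **`IsCISae.msahiE_nonneg`** (`_antitone`): Sahi positivity
  `E_n(f_0,…,f_{n−1}) ≥ 0` for all nonnegative measurable monotone families, GIVEN Lieb–Sahi's continuum statement
  `LiebSahiContinuum d n` (`= L(d,n)`, equivalent to Sahi's `C_n` restricted to dimension `d`); hence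
  UNCONDITIONALLY for `d ≤ 2` (every `n`), for `n ≤ 2` (every `d`) and for `(d, n) = (3, 3)` (the tree's kernel-only
  `SahiGridPattern.sStarD_three_nonneg`): **every CIS law on `[0,1]³` satisfies `E₃ ≥ 0`** (`IsCISae.msahiE_three_nonneg`).
  `liebSahiContinuum_iff_isCISae` — `L(d,n)` is EQUIVALENT to Sahi positivity of order `n` of all `IsCISae` laws on
  `Q_d` (they contain Lebesgue measure and are contained in its monotone images).
* The scope defect of Colangelo–Müller–Scarsini's Definition 4 (`SahiCISDefinitionFour.lean`) is thereby repaired: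
  with the a.e.-kernel notion, CIS ⇒ PA holds in every dimension (their Theorem 4 (b) ⇒ association), while the
  cylinder Definition 4 admits non-associated laws for `d ≥ 3`.

References: Müller–Stoyan 2002, Lemma 3.10.10, Thm. 3.10.11 [MullerStoyan2002]; Colangelo–Müller–Scarsini 2006 §4
[ColangeloMullerScarsini2006]; Lieb–Sahi 2022 Thm. 3.7 / Conj. (continuous case) [LiebSahi2021].  The singular-law
statements, the a.e.-pair notion and all orders `n ≥ 3` are this work.
-/

noncomputable section

namespace Summit.CriticalPhenomena.PercolationContinuityZ3.Theorems.SahiCIS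

open MeasureTheory ProbabilityTheory Set Filter Topology Function
open Summit.CriticalPhenomena.PercolationContinuityZ3.Theorems.SahiBoxTP2
open Literature.Combinatorics.Sahi2008 Literature.Probability.Percolation
open scoped ENNReal unitInterval

variable {d n : ℕ}

/-! ### The monotone coupling -/

/-- **CIS laws are monotone images of Lebesgue measure.** Every `IsCISae` probability law on `Q_d` is `G_* λ_d` for
a Borel map `G : Q_d → Q_d` monotone everywhere (standard construction + monotone version). [this work] -/
theorem IsCISae.exists_monotone_coupling (μ : Measure (Fin d → I)) [IsProbabilityMeasure μ] (hμ : IsCISae d μ) :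
    ∃ G : (Fin d → I) → (Fin d → I), Monotone G ∧ Measurable G ∧ (volume : Measure (Fin d → I)).map G = μ := by
  obtain ⟨G₀, hG₀m, hG₀, hG₀μ⟩ := IsCISae.exists_aepairmono_coupling d μ hμ
  obtain ⟨G, hGmono, hGm, hGeq⟩ := exists_monotone_map_eq_of_aepair hG₀m hG₀
  exact ⟨G, hGmono, hGm, hGeq.trans hG₀μ⟩

/-! ### Sahi positivity -/

/-- **Sahi positivity of CIS laws, increasing families**: given `LiebSahiContinuum d n`, every `IsCISae` probability
law on `Q_d` has `E_n(f_0,…,f_{n−1}) ≥ 0` for all nonnegative measurable increasing `f_i`. [this work] -/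
theorem IsCISae.msahiE_nonneg (hL : LiebSahiContinuum d n) (μ : Measure (Fin d → I)) [IsProbabilityMeasure μ]
    (hμ : IsCISae d μ) (f : Fin n → (Fin d → I) → ℝ) (hfm : ∀ i, Measurable (f i)) (hf0 : ∀ i x, 0 ≤ f i x)
    (hmono : ∀ i, Monotone (f i)) : 0 ≤ msahiE μ n f := by
  obtain ⟨G, hGmono, hGm, hGμ⟩ := hμ.exists_monotone_coupling
  rw [← hGμ]
  exact msahiE_map_nonneg_of_liebSahiContinuum hL hGm hGmono f hfm hf0 hmono

/-- **Sahi positivity of CIS laws, decreasing families.** [this work] -/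
theorem IsCISae.msahiE_nonneg_antitone (hL : LiebSahiContinuum d n) (μ : Measure (Fin d → I))
    [IsProbabilityMeasure μ] (hμ : IsCISae d μ) (f : Fin n → (Fin d → I) → ℝ) (hfm : ∀ i, Measurable (f i))
    (hf0 : ∀ i x, 0 ≤ f i x) (hanti : ∀ i, Antitone (f i)) : 0 ≤ msahiE μ n f := by
  obtain ⟨G, hGmono, hGm, hGμ⟩ := hμ.exists_monotone_coupling
  rw [← hGμ]
  exact msahiE_map_nonneg_of_liebSahiContinuum_antitone hL hGm hGmono f hfm hf0 hanti

/-- **Given Sahi's `C_n`**, every `IsCISae` law on every `Q_d` is Sahi-positive of order `n`. [this work] -/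
theorem IsCISae.msahiE_nonneg_of_sahiConjecture (hC : SahiConjecture n) (μ : Measure (Fin d → I))
    [IsProbabilityMeasure μ] (hμ : IsCISae d μ) (f : Fin n → (Fin d → I) → ℝ) (hfm : ∀ i, Measurable (f i))
    (hf0 : ∀ i x, 0 ≤ f i x) (hmono : ∀ i, Monotone (f i)) : 0 ≤ msahiE μ n f :=
  hμ.msahiE_nonneg ((sahiConjecture_iff_forall_liebSahiContinuum n).1 hC d) μ f hfm hf0 hmono

/-- UNCONDITIONAL, `d ≤ 2`: every CIS law on `[0,1]` or `[0,1]²` is Sahi-positive of EVERY order (Lieb–Sahi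
Thm. 3.7 for Lebesgue measure, transported). [this work] -/
theorem IsCISae.msahiE_nonneg_of_le_two (hd : d ≤ 2) (μ : Measure (Fin d → I)) [IsProbabilityMeasure μ]
    (hμ : IsCISae d μ) (f : Fin n → (Fin d → I) → ℝ) (hfm : ∀ i, Measurable (f i)) (hf0 : ∀ i x, 0 ≤ f i x)
    (hmono : ∀ i, Monotone (f i)) : 0 ≤ msahiE μ n f :=
  hμ.msahiE_nonneg (liebSahiContinuum_of_le_two hd n) μ f hfm hf0 hmono

/-- UNCONDITIONAL, `n ≤ 2`: every CIS law on `Q_d` has `E_1, E_2 ≥ 0` (the FKG inequality). [this work] -/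
theorem IsCISae.msahiE_nonneg_of_order_le_two (hn : n ≤ 2) (μ : Measure (Fin d → I)) [IsProbabilityMeasure μ]
    (hμ : IsCISae d μ) (f : Fin n → (Fin d → I) → ℝ) (hfm : ∀ i, Measurable (f i)) (hf0 : ∀ i x, 0 ≤ f i x)
    (hmono : ∀ i, Monotone (f i)) : 0 ≤ msahiE μ n f :=
  hμ.msahiE_nonneg (liebSahiContinuum_of_order_le_two d hn) μ f hfm hf0 hmono

/-- **UNCONDITIONAL, `(d,n) = (3,3)`: every CIS law on `[0,1]³` satisfies Sahi's third-order inequality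
`E₃(f,g,h) ≥ 0`** for nonnegative measurable increasing `f, g, h` — from the tree's KERNEL-ONLY tri-coefficient
positivity on `[3]³` (`SahiGridPattern.sStarD_three_nonneg`, 226 bilinear slice certificates checked by `decide`; standard
axioms, not the `native_decide` certificate of `SahiGrid3.liebSahiContinuum_three_three`). [this work] -/
theorem IsCISae.msahiE_three_nonneg (μ : Measure (Fin 3 → I)) [IsProbabilityMeasure μ] (hμ : IsCISae 3 μ)
    (f : Fin 3 → (Fin 3 → I) → ℝ) (hfm : ∀ i, Measurable (f i)) (hf0 : ∀ i x, 0 ≤ f i x)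
    (hmono : ∀ i, Monotone (f i)) : 0 ≤ msahiE μ 3 f :=
  hμ.msahiE_nonneg (SahiGridPattern.liebSahiContinuum_of_patternPos fun A B C =>
    SahiGridPattern.sStarD_three_nonneg A B C) μ f hfm hf0 hmono

/-- **`L(d,n)` ⟺ Sahi positivity of order `n` of all CIS laws on `Q_d`** (Lebesgue measure is CIS; CIS laws are
monotone images of it). [this work] -/
theorem liebSahiContinuum_iff_isCISae :
    LiebSahiContinuum d n ↔ ∀ (μ : Measure (Fin d → I)) [IsProbabilityMeasure μ], IsCISae d μ →
      ∀ f : Fin n → (Fin d → I) → ℝ, (∀ i, Measurable (f i)) → (∀ i x, 0 ≤ f i x) → (∀ i, Monotone (f i)) →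
        0 ≤ msahiE μ n f := by
  constructor
  · intro hL μ _ hμ f hfm hf0 hmono
    exact hμ.msahiE_nonneg hL μ f hfm hf0 hmono
  · intro h
    rw [liebSahiContinuum_iff_isBoxTP2]
    intro μ _ hμ f hfm hf0 hmono
    exact h μ (hμ.isCISae d μ) f hfm hf0 hmono

/-! ### Positive association -/

/-- **The FKG inequality for CIS laws (no density)**: `∫ f ∫ g ≤ ∫ f g` for nonnegative measurable increasing
`f, g` under every `IsCISae` probability law on `Q_d`. [this work] -/
theorem IsCISae.integral_mul_integral_le (μ : Measure (Fin d → I)) [IsProbabilityMeasure μ] (hμ : IsCISae d μ)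
    {f g : (Fin d → I) → ℝ} (hfm : Measurable f) (hgm : Measurable g) (hf0 : ∀ x, 0 ≤ f x) (hg0 : ∀ x, 0 ≤ g x)
    (hf : Monotone f) (hg : Monotone g) :
    (∫ x, f x ∂μ) * (∫ x, g x ∂μ) ≤ ∫ x, f x * g x ∂μ := by
  have h := hμ.msahiE_nonneg_of_order_le_two le_rfl μ ![f, g]
    (fun i => by fin_cases i <;> assumption) (fun i => by fin_cases i <;> assumption)
    (fun i => by fin_cases i <;> assumption)
  rw [msahiE_two] at h
  linarith

/-- **CIS ⇒ positively associated, without densities** (Müller–Stoyan Thm. 3.10.11 for arbitrary laws on `Q_d`,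
kernel hypothesis almost everywhere in pairs): `μ(A) μ(B) ≤ μ(A ∩ B)` for all measurable increasing events.
[this work] -/
theorem IsCISae.isPositivelyAssociated (μ : Measure (Fin d → I)) [IsProbabilityMeasure μ] (hμ : IsCISae d μ) :
    IsPositivelyAssociated μ := by
  refine isPositivelyAssociated_of_indicator μ fun A B hA hB hAm hBm => ?_
  obtain ⟨hAmo, hAme, hA0, -⟩ := indicator_one_props hA hAm
  obtain ⟨hBmo, hBme, hB0, -⟩ := indicator_one_props hB hBm
  exact hμ.integral_mul_integral_le μ hAme hBme hA0 hB0 hAmo hBmo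

end Summit.CriticalPhenomena.PercolationContinuityZ3.Theorems.SahiCIS

end
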